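import Literature.NumberTheory.EllipticCurves.Kobayashi2003.SignedSelmerEtaComponentFacts
import Literature.NumberTheory.EllipticCurves.CyclotomicInterpolantUniquenessProofs
import Mathlib.NumberTheory.LegendreSymbol.QuadraticChar.Basic
import Mathlib.RingTheory.Polynomial.Cyclotomic.Roots
import Mathlib.FieldTheory.IsAlgClosed.Basic
import HarnessLib

/-!
# Kobayashi 2003, Thm. 3.2 with (3.4)–(3.7) on the quadratic branch `η = ω^{(p−1)/2}`: the functions
# `L_p^±(E, η, X)` are DETERMINED UP TO A UNIT of `ℤ_p` by their interpolation property, so the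
# IDEALS `(L_p⁺(E, η, X))`, `(L_p⁻(E, η, X))` of the `η`-main conjectures are choice-free
# (proofs only; no named fact; net debt 0)

Topic `NumberTheory/EllipticCurves`, sub-directory `Kobayashi2003` (namespace = path). Cell `bsd-cm`
(HOME `run/shared/lean/pub/bsd-cm/`), seat `bsd-cm-k8i-ty` g7 (literature-prover, typer lane), rung
K8-inert of `BirchSwinnertonDyer`, route `InertBadSignedBranches`, item stmt-BirchSwinnertonDyer-19501
`PlusMCEtaK` (Kobayashi's even main conjecture at `η` for a CM curve). HONEST FRAMING (cell bsd-cm):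
the programme assembles the Birch–Swinnerton-Dyer formula for analytic-rank `≤ 1` curves STRICTLY from
published theorems and TYPES the remainder; BSD is not proved by any of this; a closed item closes a
rung leaf, never the summit. THIS FILE: THEOREMS ONLY — the Literature-side twin of the Summits-side
uniqueness theorems of cell `b2b-bsdres` (seat x1b GEN 29,
`Summits/…/Rank1Residual/Additive/QuadraticBranch{Minus,Plus}LFunctionUnique.lean`, whose predicates
`Additive.IsQuadraticBranch{Plus,Minus}LFunction` have bodies IDENTICAL to the Literature predicates
`Kobayashi2003.IsQuadraticBranch{Plus,Minus}LFunction` of `SignedSelmerEtaComponentFacts.lean`), so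
that LITERATURE files — which may not import `Summits/` — can discharge the displayed uniqueness
hypothesis `huniq` of `BurungaleTian2026/EtaSignedMainConjectureTensorQ.lean` §3–§5 by name; the
pattern is that of the sibling `Kobayashi2003/SignedPAdicLFunctionUniqueProofs.lean` (the `η = 1`
predicate `IsSignedPAdicLFunction`). No instance, no notation, no attribute is declared or removed.

## What this settles about the reading flag `Kob03-Lpm-eta-upto-unit`

The predicates `IsQuadraticBranchPlusLFunction f p ϖ L` / `IsQuadraticBranchMinusLFunction f p ϖ L`
pin `L` only UP TO A UNIT `u ∈ ℤ_pˣ` (the `∃ u` in their bodies — flag `Kob03-Lpm-eta-upto-unit` of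
the sibling file). The theorems below prove that any two solutions differ by a unit of `ℤ_p`
(`….exists_units_smul_eq`), hence generate the SAME principal ideal of `Λ = ℤ_p⟦X⟧`
(`….span_singleton_eq`): every characteristic-IDEAL statement quantified over "every `L` with the
interpolation property" — the `η`-main conjectures of [Kob03] §4 as typed in the tree
(`Kobayashi2003.thm74_etaEvenMC_iff_etaOddMC`, the K8-inert route's `PlusMCEtaK`, the
`BurungaleTian2026` criteria) — is therefore EXACTLY the printed statement about Kobayashi's own
`L_p^±(E, η, X)`, neither weaker nor stronger on this count. (Existence of a solution is [Kob03]
Thm. 3.2 = Pollack; it is not asserted here.)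

## Source, verbatim ([Kobayashi2003] S. Kobayashi, *Iwasawa theory for elliptic curves at
## supersingular primes*, Invent. Math. 152 (2003) 1–36, p. 7; held text
## `paper:doi-10-1007-s00222-002-0265-4`, page = file number)

"**Theorem 3.2 (Pollack).** … there exist `L_p^±(E, η, X) ∈ Λ_η` such that … (3.4) [even `n`] …
(3.5) [odd `n`] … for every character `ψ` of `G_n` of conductor `p^{n+1}` with `ψ|_Δ = η` … (3.6)
`L_p⁺(E, η, 0) = …`, (3.7) `L_p⁻(E, η, 0) = 0`." The interpolation property at ALL levels `n` of the
right parity determines an element of `Λ` (an Iwasawa function is determined by its values at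
infinitely many points `ζ − 1` of the open unit disc: Weierstrass preparation, Washington GTM 83
Thm. 7.3; [Pollack2003] proof of Prop. 6.9).

## Argument (as Summits-side, verbatim port)

Given two solutions with units `u₁, u₂`, the element `D = u₂·L₁ − u₁·L₂ ∈ Λ` vanishes at `ζ_n − 1`
for every primitive `p^n`-th root of unity `ζ_n ∈ ℂ_p` with `n` of the right parity (`n ≥ 1`):
there IS a character `ψ` mod `p^{n+1}` of order exactly `2pⁿ` with `ψ(1+p) = ζ_n`
(`exists_dirichletCharacter_orderOf_two_mul_prime_pow`: the quadratic character mod `p` lifted to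
level `p^{n+1}` — order `2`, value `1` at `γ = 1 + p` — times the character of `Γ` with `χ(γ) = ζ_n`
supplied by the tree's `exists_character_apply_cyclotomicGenerator_eq`, whose order is pinned to `pⁿ`),
so `D` has infinitely many zeros in the open unit disc and `D = 0`
(`MemIwasawaRat.finite_setOf_hasSum_zero`), i.e. `L₂ = (u₂/u₁)·L₁`.

## Contents

§1 `exists_dirichletCharacter_orderOf_two_mul_prime_pow` (with private helpers). §2
`IsQuadraticBranchMinusLFunction.exists_units_smul_eq` / `IsQuadraticBranchPlusLFunction.exists_units_smul_eq`
(two solutions differ by a unit), `….span_singleton_eq` (the ideals agree),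
`IsQuadraticBranchMinusLFunction.coeff_one_eq_zero_iff`, `IsQuadraticBranchPlusLFunction.constantCoeff_eq_zero_iff`
(the order-of-vanishing readings are choice-free). §3 (appended) `IsQuadraticBranchMinusLFunction.X_dvd` /
`….exists_eq_X_mul` ((3.7): `X ∣ L_p⁻(E, η, X)`, so the odd readings «`Lm = X·L' → …`» are never vacuous).

References: [Kobayashi2003] Thm. 3.2, (3.4)–(3.7) (p. 7), §4 (p. 8); [Pollack2003] R. Pollack, Duke
Math. J. 118 (2003), Prop. 6.9 (proof), §3; [MazurTateTeitelbaum1986Invent] §I.12–I.14; L. Washington,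
GTM 83, Thm. 7.3. Tree: `Kobayashi2003/SignedSelmerEtaComponentFacts.lean` (the predicates),
`CyclotomicInterpolantUniquenessProofs.lean` (`exists_character_apply_cyclotomicGenerator_eq`),
`PAdicPowerSeriesZeros.lean` (`MemIwasawaRat.finite_setOf_hasSum_zero`), `PAdicBSD.lean`
(`iwasawaToPowerSeries`); Summits-side originals (cell b2b-bsdres, x1b GEN 29) cited above.
-/

noncomputable section

open scoped Classical MatrixGroups ModularForm

open CongruenceSubgroup Polynomial Literature.NumberTheory.EllipticCurves
  Literature.NumberTheory.EllipticCurves.ModularForms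

namespace Literature.NumberTheory.EllipticCurves.Kobayashi2003

variable {p : ℕ} [hp : Fact p.Prime]

/-! ## §1 Characters of order `2pⁿ` modulo `p^{n+1}` with prescribed value at `γ` -/

/-- Primitive `p^n`-th roots of unity exist in `ℂ_p`. [folklore] -/
private theorem exists_isPrimitiveRoot_padicComplex_pow (n : ℕ) :
    ∃ ζ : ℂ_[p], IsPrimitiveRoot ζ (p ^ n) := by
  have hpos : 0 < p ^ n := pow_pos hp.out.pos n
  obtain ⟨ζ, hζ⟩ := IsAlgClosed.exists_root (cyclotomic (p ^ n) ℂ_[p])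
    (degree_cyclotomic_pos (p ^ n) ℂ_[p] hpos).ne'
  exact ⟨ζ, (isRoot_cyclotomic_iff_charZero hpos).mp hζ⟩

/-- A multiplicative character of `(ℤ/m)` kills the order of the unit group:
`χ ^ #(ℤ/m)^× = 1`. [folklore] -/
private theorem mulChar_pow_card_units_eq_one' {R : Type*} [CommMonoidWithZero R] {m : ℕ} [NeZero m]
    (χ : DirichletCharacter R m) : χ ^ Fintype.card (ZMod m)ˣ = 1 := by
  ext a
  rw [MulChar.pow_apply_coe, ← map_pow, ← Units.val_pow_eq_pow_val, pow_card_eq_one,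
    Units.val_one, map_one, MulChar.one_apply_coe]

/-- **The quadratic character modulo an odd prime `p`, with values in `ℂ_p`, has order `2`.**
[folklore] -/
private theorem orderOf_quadraticChar_ringHomComp_padicComplex (hp2 : p ≠ 2) :
    orderOf ((quadraticChar (ZMod p)).ringHomComp (Int.castRingHom ℂ_[p])) = 2 := by
  set chiQ : MulChar (ZMod p) ℂ_[p] := (quadraticChar (ZMod p)).ringHomComp (Int.castRingHom ℂ_[p])
  have hq : chiQ.IsQuadratic := (quadraticChar_isQuadratic (ZMod p)).comp _
  refine orderOf_eq_prime hq.sq_eq_one fun h1 ↦ ?_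
  have hchar : ringChar (ZMod p) ≠ 2 := by rwa [ZMod.ringChar_zmod_n]
  obtain ⟨a, ha⟩ := quadraticChar_exists_neg_one hchar
  have h := congrArg (fun χ : MulChar (ZMod p) ℂ_[p] ↦ χ a) h1
  simp only [chiQ, MulChar.ringHomComp_apply, ha, map_neg, map_one] at h
  have ha0 : a ≠ 0 := by
    rintro rfl
    rw [quadraticChar_zero] at ha
    exact absurd ha (by norm_num)
  rw [MulChar.one_apply (Ne.isUnit ha0)] at h
  exact absurd h (by norm_num)

/-- **For `p` odd, `n ≥ 1` and `ζ ∈ ℂ_p` a primitive `pⁿ`-th root of unity, there is a Dirichlet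
character `ψ` modulo `p^{n+1}` of order exactly `2pⁿ` with `ψ(γ) = ζ`** (`γ = 1 + p` the tree's
`cyclotomicGenerator`): `ψ = η·χ` with `η` the quadratic character mod `p` (order `2`, `η(γ) = 1`)
and `χ` the character of `Γ` with `χ(γ) = ζ` of the tree's
`exists_character_apply_cyclotomicGenerator_eq` (its `p`-power order is `pⁿ`: at least the order
`pⁿ` of `χ(γ)`, at most the `p`-part of `#(ℤ/p^{n+1})^× = pⁿ(p-1)`). These are exactly the `ψ` of
Kobayashi's (3.4)/(3.5) at level `n` («every character `ψ` of `G_n` of conductor `p^{n+1}` with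
`ψ|_Δ = η`»). Literature twin of the Summits-side theorem of the same name (x1b GEN 29).
[cite: Kobayashi2003, §3 (3.4)–(3.5) (p. 7)] [cite: MazurTateTeitelbaum1986Invent, §I.13] -/
theorem exists_dirichletCharacter_orderOf_two_mul_prime_pow (hp2 : p ≠ 2) {n : ℕ} (hn : 0 < n)
    {ζ : ℂ_[p]} (hζ : IsPrimitiveRoot ζ (p ^ n)) :
    ∃ ψ : DirichletCharacter ℂ_[p] (p ^ (n + 1)),
      orderOf ψ = 2 * p ^ n ∧ ψ (cyclotomicGenerator p : ZMod (p ^ (n + 1))) = ζ := by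
  have hP : p.Prime := hp.out
  have he : cyclotomicExponent p = 1 := if_neg hp2
  obtain ⟨j, rfl⟩ : ∃ j, n = j + 1 := ⟨n - 1, by omega⟩
  haveI : NeZero (p ^ (j + 1 + 1)) := ⟨pow_ne_zero _ hP.ne_zero⟩
  -- the character of `Γ` with `χ(γ) = ζ`, transported to level `p^{j+2}`
  obtain ⟨χ, -, -, ⟨i, hi⟩, hχγ⟩ := exists_character_apply_cyclotomicGenerator_eq (p := p) j hζ
  have hL : p ^ (j + 1 + cyclotomicExponent p) ∣ p ^ (j + 1 + 1) := by rw [he]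
  set χ' : DirichletCharacter ℂ_[p] (p ^ (j + 1 + 1)) := DirichletCharacter.changeLevel hL χ
    with hχ'_def
  have hordχ' : orderOf χ' = p ^ i := by
    rw [hχ'_def, orderOf_injective (DirichletCharacter.changeLevel hL)
      (DirichletCharacter.changeLevel_injective hL) χ, hi]
  -- the value at `γ` is unchanged
  have hcopZ : IsCoprime ((cyclotomicGenerator p : ℕ) : ℤ) ((p ^ (j + 1 + 1) : ℕ) : ℤ) := by
    rw [Nat.isCoprime_iff_coprime]
    refine Nat.Coprime.pow_right _ ?_
    rw [cyclotomicGenerator, he, pow_one, Nat.coprime_add_self_left]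
    exact Nat.coprime_one_left p
  have hχ'γ : χ' (cyclotomicGenerator p : ZMod (p ^ (j + 1 + 1))) = ζ := by
    have h1 := DirichletCharacter.changeLevel_eq_cast_of_dvd' χ hL
      (a := ((cyclotomicGenerator p : ℕ) : ℤ)) (by exact_mod_cast hcopZ)
    rw [Int.cast_natCast, Int.cast_natCast] at h1
    rw [hχ'_def, h1]
    -- `χ` at its own level: the cast of `γ` is the same numeral
    convert hχγ using 2
  -- pin the order: `orderOf χ' = p^(j+1)`
  have hζord : orderOf ζ = p ^ (j + 1) := hζ.eq_orderOf.symm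
  have hge : j + 1 ≤ i := by
    have h1 : ζ ^ p ^ i = 1 := by
      rw [← hχ'γ, ← MulChar.pow_apply' χ' (pow_ne_zero _ hP.ne_zero), ← hordχ', pow_orderOf_eq_one,
        MulChar.one_apply (isUnit_cyclotomicGenerator_cast p _)]
    have h2 : p ^ (j + 1) ∣ p ^ i := by rw [← hζord]; exact orderOf_dvd_of_pow_eq_one h1
    exact (Nat.pow_dvd_pow_iff_le_right hP.one_lt).mp h2
  have hle : i ≤ j + 1 := by
    have h1 : orderOf χ' ∣ Fintype.card (ZMod (p ^ (j + 1 + 1)))ˣ :=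
      orderOf_dvd_of_pow_eq_one (mulChar_pow_card_units_eq_one' χ')
    rw [hordχ', ZMod.card_units_eq_totient, Nat.totient_prime_pow hP (by omega),
      show j + 1 + 1 - 1 = j + 1 from rfl] at h1
    have hcop : Nat.Coprime (p ^ i) (p - 1) :=
      Nat.Coprime.pow_left _ ((Nat.coprime_self_sub_right hP.one_le).mpr (Nat.coprime_one_right p))
    have h2 : p ^ i ∣ p ^ (j + 1) := hcop.dvd_of_dvd_mul_right h1
    exact (Nat.pow_dvd_pow_iff_le_right hP.one_lt).mp h2
  have hord : orderOf χ' = p ^ (j + 1) := by rw [hordχ', le_antisymm hle hge]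
  -- the quadratic character mod `p`, lifted to level `p^{j+2}`
  set chiQ0 : DirichletCharacter ℂ_[p] p := (quadraticChar (ZMod p)).ringHomComp (Int.castRingHom ℂ_[p])
    with hchiQ0_def
  have hdvd : p ∣ p ^ (j + 1 + 1) := dvd_pow_self p (by omega)
  set chiQ : DirichletCharacter ℂ_[p] (p ^ (j + 1 + 1)) := DirichletCharacter.changeLevel hdvd chiQ0
    with hchiQ_def
  have hordchiQ : orderOf chiQ = 2 := by
    rw [hchiQ_def, orderOf_injective (DirichletCharacter.changeLevel hdvd)
      (DirichletCharacter.changeLevel_injective hdvd) chiQ0, hchiQ0_def,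
      orderOf_quadraticChar_ringHomComp_padicComplex hp2]
  have hchiQγ : chiQ (cyclotomicGenerator p : ZMod (p ^ (j + 1 + 1))) = 1 := by
    have h1 := DirichletCharacter.changeLevel_eq_cast_of_dvd' chiQ0 hdvd
      (a := ((cyclotomicGenerator p : ℕ) : ℤ)) (by exact_mod_cast hcopZ)
    rw [Int.cast_natCast, Int.cast_natCast] at h1
    rw [hchiQ_def, h1, cyclotomicGenerator, he, pow_one, Nat.cast_add, Nat.cast_one, ZMod.natCast_self,
      add_zero, map_one]
  -- the product
  refine ⟨chiQ * χ', ?_, ?_⟩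
  · have hcop : Nat.Coprime (orderOf chiQ) (orderOf χ') := by
      rw [hordchiQ, hord]
      exact Nat.Coprime.pow_right _ (Nat.coprime_two_left.mpr (hP.odd_of_ne_two hp2))
    rw [(Commute.all chiQ χ').orderOf_mul_eq_mul_orderOf_of_coprime hcop, hordchiQ, hord]
  · rw [MulChar.mul_apply, hchiQγ, hχ'γ, one_mul]

/-! ## §2 Uniqueness up to a unit, and the ideals -/

section Unique

variable {N : ℕ} {f : CuspForm (Gamma0 N) 2}

/-- **Two solutions of Kobayashi's quadratic-branch interpolation property (3.5)+(3.7) (MINUS sign,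
odd levels) differ by a unit of `ℤ_p`** (`p` odd): if `IsQuadraticBranchMinusLFunction f p ϖ L₁` and
`… L₂` then `L₂ = v • L₁` for some `v ∈ ℤ_pˣ`. Literature twin of the Summits-side theorem of the same
name (x1b GEN 29). [cite: Kobayashi2003, Thm. 3.2 and (3.5), (3.7) (p. 7)]
[cite: Pollack2003, Prop. 6.9 (proof) and §3] [cite: MazurTateTeitelbaum1986Invent, §I.12–I.14] -/
theorem IsQuadraticBranchMinusLFunction.exists_units_smul_eq (hp2 : p ≠ 2) {ϖ : ℚ}
    {L₁ L₂ : IwasawaAlgebra p} (h₁ : IsQuadraticBranchMinusLFunction f p ϖ L₁)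
    (h₂ : IsQuadraticBranchMinusLFunction f p ϖ L₂) :
    ∃ v : ℤ_[p]ˣ, L₂ = (v : ℤ_[p]) • L₁ := by
  have hP : p.Prime := hp.out
  obtain ⟨-, u₁, H₁⟩ := h₁
  obtain ⟨-, u₂, H₂⟩ := h₂
  -- `D = u₂ L₁ - u₁ L₂`
  set D : IwasawaAlgebra p := (u₂ : ℤ_[p]) • L₁ - (u₁ : ℤ_[p]) • L₂ with hDdef
  suffices hD0 : D = 0 by
    refine ⟨u₁⁻¹ * u₂, ?_⟩
    have h : (u₁ : ℤ_[p]) • L₂ = (u₂ : ℤ_[p]) • L₁ := (sub_eq_zero.mp hD0).symm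
    calc L₂ = ((u₁⁻¹ * u₁ : ℤ_[p]ˣ) : ℤ_[p]) • L₂ := by rw [inv_mul_cancel, Units.val_one, one_smul]
      _ = ((u₁⁻¹ : ℤ_[p]ˣ) : ℤ_[p]) • ((u₁ : ℤ_[p]) • L₂) := by rw [Units.val_mul, mul_smul]
      _ = ((u₁⁻¹ * u₂ : ℤ_[p]ˣ) : ℤ_[p]) • L₁ := by rw [h, ← mul_smul, ← Units.val_mul]
  by_contra hD
  have hD' : iwasawaToPowerSeries p D ≠ 0 := fun h0 ↦
    hD (iwasawaToPowerSeries_injective p (by rw [h0, map_zero]))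
  have hfin := MemIwasawaRat.finite_setOf_hasSum_zero (memIwasawaRat_iwasawaToPowerSeries p D) hD'
  -- the levels `n_k = 2k + 1` and points `ζ_k` of order `p^{n_k}`
  choose ζ hζ using fun k : ℕ ↦ exists_isPrimitiveRoot_padicComplex_pow (p := p) (2 * k + 1)
  choose ψ hψ using fun k : ℕ ↦
    exists_dirichletCharacter_orderOf_two_mul_prime_pow hp2 (Nat.succ_pos (2 * k)) (hζ k)
  set ι : ℤ_[p] →+* ℂ_[p] := (algebraMap ℚ_[p] ℂ_[p]).comp (algebraMap ℤ_[p] ℚ_[p]) with hι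
  have hcoe : ∀ (L : IwasawaAlgebra p) (k : ℕ),
      algebraMap ℚ_[p] ℂ_[p] (PowerSeries.coeff k (iwasawaToPowerSeries p L)) =
        ι (PowerSeries.coeff k L) := by
    intro L k
    simp only [hι, RingHom.comp_apply, iwasawaToPowerSeries, PowerSeries.coeff_map]
  have hcoeffD : ∀ k, PowerSeries.coeff k D =
      (u₂ : ℤ_[p]) * PowerSeries.coeff k L₁ - (u₁ : ℤ_[p]) * PowerSeries.coeff k L₂ := by
    intro k
    rw [hDdef, map_sub, PowerSeries.coeff_smul, PowerSeries.coeff_smul, smul_eq_mul, smul_eq_mul]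
  -- every `ζ_k - 1` is a zero of `D` in the open unit disc
  have hmem : ∀ k, ζ k - 1 ∈ {z : ℂ_[p] | ‖z‖ < 1 ∧
      HasSum (fun j ↦ algebraMap ℚ_[p] ℂ_[p] (PowerSeries.coeff j (iwasawaToPowerSeries p D)) *
        z ^ j) 0} := by
    intro k
    have hz : ‖ζ k - 1‖ < 1 := norm_sub_one_lt_one_of_pow_prime_pow_eq_one (hζ k).pow_eq_one
    refine ⟨hz, ?_⟩
    have e₁ := H₁ (2 * k + 1) ⟨k, rfl⟩ (ψ k) (hψ k).1
    have e₂ := H₂ (2 * k + 1) ⟨k, rfl⟩ (ψ k) (hψ k).1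
    rw [(hψ k).2] at e₁ e₂
    have hsub := (e₁.mul_left (ι u₂)).sub (e₂.mul_left (ι u₁))
    have hrhs : ι (u₂ : ℤ_[p]) * ((-1 : ℂ_[p]) ^ ((2 * k + 1 + 1) / 2) *
          algebraMap ℚ_[p] ℂ_[p] (((u₁ : ℤ_[p]) : ℚ_[p]) * (ϖ : ℚ_[p])) *
          (if Even (p / 2) then ratTwistedSymbolSum f (ψ k) else ratMinusTwistedSymbolSum f (ψ k)) /
        (cyclotomicOmegaPlus p (2 * k + 1)).eval₂ (algebraMap ℤ ℂ_[p]) (ζ k - 1)) -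
        ι (u₁ : ℤ_[p]) * ((-1 : ℂ_[p]) ^ ((2 * k + 1 + 1) / 2) *
          algebraMap ℚ_[p] ℂ_[p] (((u₂ : ℤ_[p]) : ℚ_[p]) * (ϖ : ℚ_[p])) *
          (if Even (p / 2) then ratTwistedSymbolSum f (ψ k) else ratMinusTwistedSymbolSum f (ψ k)) /
        (cyclotomicOmegaPlus p (2 * k + 1)).eval₂ (algebraMap ℤ ℂ_[p]) (ζ k - 1)) = 0 := by
      have hu : ∀ u : ℤ_[p]ˣ, algebraMap ℚ_[p] ℂ_[p] (((u : ℤ_[p]) : ℚ_[p]) * (ϖ : ℚ_[p])) =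
          ι (u : ℤ_[p]) * algebraMap ℚ_[p] ℂ_[p] (ϖ : ℚ_[p]) := by
        intro u
        rw [map_mul, hι, RingHom.comp_apply, PadicInt.algebraMap_apply]
      rw [hu u₁, hu u₂]
      ring
    rw [hrhs] at hsub
    have hfun : (fun j ↦ algebraMap ℚ_[p] ℂ_[p] (PowerSeries.coeff j (iwasawaToPowerSeries p D)) *
        (ζ k - 1) ^ j) = fun j ↦
        ι (u₂ : ℤ_[p]) * (ι (PowerSeries.coeff j L₁) * (ζ k - 1) ^ j) -
          ι (u₁ : ℤ_[p]) * (ι (PowerSeries.coeff j L₂) * (ζ k - 1) ^ j) := by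
      funext j
      rw [hcoe, hcoeffD, map_sub, map_mul, map_mul]
      ring
    rw [hfun]
    exact hsub
  -- the zeros are pairwise distinct
  have hinjζ : Function.Injective fun k ↦ ζ k - 1 := by
    intro a b hab
    have hζab : ζ a = ζ b := sub_left_injective hab
    have ho : p ^ (2 * a + 1) = p ^ (2 * b + 1) := by
      rw [(hζ a).eq_orderOf, (hζ b).eq_orderOf, hζab]
    have := Nat.pow_right_injective hP.two_le ho
    omega
  exact hfin.not_infinite
    ((Set.infinite_range_of_injective hinjζ).mono (Set.range_subset_iff.mpr hmem))

/-- **Two solutions of Kobayashi's quadratic-branch interpolation property (3.4)+(3.6) (PLUS sign,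
even levels) differ by a unit of `ℤ_p`** (`p` odd). Same proof as the minus sign, along the even
levels `n = 2k + 2`. Literature twin of the Summits-side theorem of the same name (x1b GEN 29).
[cite: Kobayashi2003, Thm. 3.2 and (3.4), (3.6) (p. 7)]
[cite: Pollack2003, Prop. 6.9 (proof) and §3] [cite: MazurTateTeitelbaum1986Invent, §I.12–I.14] -/
theorem IsQuadraticBranchPlusLFunction.exists_units_smul_eq (hp2 : p ≠ 2) {ϖ : ℚ}
    {L₁ L₂ : IwasawaAlgebra p} (h₁ : IsQuadraticBranchPlusLFunction f p ϖ L₁)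
    (h₂ : IsQuadraticBranchPlusLFunction f p ϖ L₂) :
    ∃ v : ℤ_[p]ˣ, L₂ = (v : ℤ_[p]) • L₁ := by
  have hP : p.Prime := hp.out
  obtain ⟨u₁, H₁⟩ := h₁
  obtain ⟨u₂, H₂⟩ := h₂
  set D : IwasawaAlgebra p := (u₂ : ℤ_[p]) • L₁ - (u₁ : ℤ_[p]) • L₂ with hDdef
  suffices hD0 : D = 0 by
    refine ⟨u₁⁻¹ * u₂, ?_⟩
    have h : (u₁ : ℤ_[p]) • L₂ = (u₂ : ℤ_[p]) • L₁ := (sub_eq_zero.mp hD0).symm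
    calc L₂ = ((u₁⁻¹ * u₁ : ℤ_[p]ˣ) : ℤ_[p]) • L₂ := by rw [inv_mul_cancel, Units.val_one, one_smul]
      _ = ((u₁⁻¹ : ℤ_[p]ˣ) : ℤ_[p]) • ((u₁ : ℤ_[p]) • L₂) := by rw [Units.val_mul, mul_smul]
      _ = ((u₁⁻¹ * u₂ : ℤ_[p]ˣ) : ℤ_[p]) • L₁ := by rw [h, ← mul_smul, ← Units.val_mul]
  by_contra hD
  have hD' : iwasawaToPowerSeries p D ≠ 0 := fun h0 ↦
    hD (iwasawaToPowerSeries_injective p (by rw [h0, map_zero]))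
  have hfin := MemIwasawaRat.finite_setOf_hasSum_zero (memIwasawaRat_iwasawaToPowerSeries p D) hD'
  -- even levels `n_k = 2k + 2`, points `ζ_k` of order `p^{n_k}`
  choose ζ hζ using fun k : ℕ ↦ exists_isPrimitiveRoot_padicComplex_pow (p := p) (2 * k + 2)
  choose ψ hψ using fun k : ℕ ↦
    exists_dirichletCharacter_orderOf_two_mul_prime_pow hp2 (Nat.succ_pos (2 * k + 1)) (hζ k)
  set ι : ℤ_[p] →+* ℂ_[p] := (algebraMap ℚ_[p] ℂ_[p]).comp (algebraMap ℤ_[p] ℚ_[p]) with hι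
  have hcoe : ∀ (L : IwasawaAlgebra p) (k : ℕ),
      algebraMap ℚ_[p] ℂ_[p] (PowerSeries.coeff k (iwasawaToPowerSeries p L)) =
        ι (PowerSeries.coeff k L) := by
    intro L k
    simp only [hι, RingHom.comp_apply, iwasawaToPowerSeries, PowerSeries.coeff_map]
  have hcoeffD : ∀ k, PowerSeries.coeff k D =
      (u₂ : ℤ_[p]) * PowerSeries.coeff k L₁ - (u₁ : ℤ_[p]) * PowerSeries.coeff k L₂ := by
    intro k
    rw [hDdef, map_sub, PowerSeries.coeff_smul, PowerSeries.coeff_smul, smul_eq_mul, smul_eq_mul]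
  have hmem : ∀ k, ζ k - 1 ∈ {z : ℂ_[p] | ‖z‖ < 1 ∧
      HasSum (fun j ↦ algebraMap ℚ_[p] ℂ_[p] (PowerSeries.coeff j (iwasawaToPowerSeries p D)) *
        z ^ j) 0} := by
    intro k
    have hz : ‖ζ k - 1‖ < 1 := norm_sub_one_lt_one_of_pow_prime_pow_eq_one (hζ k).pow_eq_one
    refine ⟨hz, ?_⟩
    have e₁ := H₁ (2 * k + 2) ⟨k + 1, by ring⟩ (ψ k) (hψ k).1
    have e₂ := H₂ (2 * k + 2) ⟨k + 1, by ring⟩ (ψ k) (hψ k).1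
    rw [(hψ k).2] at e₁ e₂
    have hsub := (e₁.mul_left (ι u₂)).sub (e₂.mul_left (ι u₁))
    have hrhs : ι (u₂ : ℤ_[p]) * ((-1 : ℂ_[p]) ^ ((2 * k + 2) / 2 + 1) *
          algebraMap ℚ_[p] ℂ_[p] (((u₁ : ℤ_[p]) : ℚ_[p]) * (ϖ : ℚ_[p])) *
          (if Even (p / 2) then ratTwistedSymbolSum f (ψ k) else ratMinusTwistedSymbolSum f (ψ k)) /
        (cyclotomicOmegaMinus p (2 * k + 2)).eval₂ (algebraMap ℤ ℂ_[p]) (ζ k - 1)) -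
        ι (u₁ : ℤ_[p]) * ((-1 : ℂ_[p]) ^ ((2 * k + 2) / 2 + 1) *
          algebraMap ℚ_[p] ℂ_[p] (((u₂ : ℤ_[p]) : ℚ_[p]) * (ϖ : ℚ_[p])) *
          (if Even (p / 2) then ratTwistedSymbolSum f (ψ k) else ratMinusTwistedSymbolSum f (ψ k)) /
        (cyclotomicOmegaMinus p (2 * k + 2)).eval₂ (algebraMap ℤ ℂ_[p]) (ζ k - 1)) = 0 := by
      have hu : ∀ u : ℤ_[p]ˣ, algebraMap ℚ_[p] ℂ_[p] (((u : ℤ_[p]) : ℚ_[p]) * (ϖ : ℚ_[p])) =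
          ι (u : ℤ_[p]) * algebraMap ℚ_[p] ℂ_[p] (ϖ : ℚ_[p]) := by
        intro u
        rw [map_mul, hι, RingHom.comp_apply, PadicInt.algebraMap_apply]
      rw [hu u₁, hu u₂]
      ring
    rw [hrhs] at hsub
    have hfun : (fun j ↦ algebraMap ℚ_[p] ℂ_[p] (PowerSeries.coeff j (iwasawaToPowerSeries p D)) *
        (ζ k - 1) ^ j) = fun j ↦
        ι (u₂ : ℤ_[p]) * (ι (PowerSeries.coeff j L₁) * (ζ k - 1) ^ j) -
          ι (u₁ : ℤ_[p]) * (ι (PowerSeries.coeff j L₂) * (ζ k - 1) ^ j) := by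
      funext j
      rw [hcoe, hcoeffD, map_sub, map_mul, map_mul]
      ring
    rw [hfun]
    exact hsub
  have hinjζ : Function.Injective fun k ↦ ζ k - 1 := by
    intro a b hab
    have hζab : ζ a = ζ b := sub_left_injective hab
    have ho : p ^ (2 * a + 2) = p ^ (2 * b + 2) := by
      rw [(hζ a).eq_orderOf, (hζ b).eq_orderOf, hζab]
    have := Nat.pow_right_injective hP.two_le ho
    omega
  exact hfin.not_infinite
    ((Set.infinite_range_of_injective hinjζ).mono (Set.range_subset_iff.mpr hmem))

/-- **The ideal `(L_p⁺(E, η, X))` of the even main conjecture at `η` is choice-free**: any two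
solutions of (3.4)+(3.6) generate the same principal ideal of `Λ`. So a characteristic-ideal statement
quantified over every `Lp` with `IsQuadraticBranchPlusLFunction f p ϖ Lp` (e.g. the K8-inert route's
item `PlusMCEtaK`, the fact `thm74_etaEvenMC_iff_etaOddMC`) is Kobayashi's printed «Even main
conjecture» at `η` for his function and nothing more. This is the Literature discharge of the
displayed hypothesis `huniq` of `BurungaleTian2026/EtaSignedMainConjectureTensorQ.lean` §3–§4.
[cite: Kobayashi2003, §4 Even main conjecture (p. 8) and (3.4) (p. 7)] -/
theorem IsQuadraticBranchPlusLFunction.span_singleton_eq (hp2 : p ≠ 2) {ϖ : ℚ}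
    {L₁ L₂ : IwasawaAlgebra p} (h₁ : IsQuadraticBranchPlusLFunction f p ϖ L₁)
    (h₂ : IsQuadraticBranchPlusLFunction f p ϖ L₂) :
    Ideal.span ({L₁} : Set (IwasawaAlgebra p)) = Ideal.span {L₂} := by
  obtain ⟨v, hv⟩ := h₁.exists_units_smul_eq hp2 h₂
  rw [hv, Algebra.smul_def]
  exact (Ideal.span_singleton_mul_left_unit ((v.map (algebraMap ℤ_[p] (IwasawaAlgebra p) :
    ℤ_[p] →* IwasawaAlgebra p)).isUnit) L₁).symm

/-- **The ideal `(L_p⁻(E, η, X))` — and hence `(X⁻¹L_p⁻(E, η, X))` — of the odd main conjecture at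
`η` is choice-free** (minus sign). The Literature discharge of the displayed hypothesis `huniq` of
`BurungaleTian2026/EtaSignedMainConjectureTensorQ.lean` §5.
[cite: Kobayashi2003, §4 Odd main conjecture (p. 8) and (3.5), (3.7) (p. 7)] -/
theorem IsQuadraticBranchMinusLFunction.span_singleton_eq (hp2 : p ≠ 2) {ϖ : ℚ}
    {L₁ L₂ : IwasawaAlgebra p} (h₁ : IsQuadraticBranchMinusLFunction f p ϖ L₁)
    (h₂ : IsQuadraticBranchMinusLFunction f p ϖ L₂) :
    Ideal.span ({L₁} : Set (IwasawaAlgebra p)) = Ideal.span {L₂} := by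
  obtain ⟨v, hv⟩ := h₁.exists_units_smul_eq hp2 h₂
  rw [hv, Algebra.smul_def]
  exact (Ideal.span_singleton_mul_left_unit ((v.map (algebraMap ℤ_[p] (IwasawaAlgebra p) :
    ℤ_[p] →* IwasawaAlgebra p)).isUnit) L₁).symm

/-- **If `Lm = X·L'`, the ideal `(L')` is choice-free too** (`Λ` is a domain: from
`v • (X·L'₁) = X·L'₂` cancel `X`). This is the form in which the K8-inert route and the
`BurungaleTian2026` criteria read the odd main conjecture at `η ≠ 1` («`((1/X)L⁻_p(E, η, X))`»).
[cite: Kobayashi2003, §4 Odd main conjecture (p. 8) and (3.7) (p. 7)] -/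
theorem IsQuadraticBranchMinusLFunction.span_singleton_div_X_eq (hp2 : p ≠ 2) {ϖ : ℚ}
    {L₁ L₂ L'₁ L'₂ : IwasawaAlgebra p} (h₁ : IsQuadraticBranchMinusLFunction f p ϖ L₁)
    (h₂ : IsQuadraticBranchMinusLFunction f p ϖ L₂) (hL₁ : L₁ = PowerSeries.X * L'₁)
    (hL₂ : L₂ = PowerSeries.X * L'₂) :
    Ideal.span ({L'₁} : Set (IwasawaAlgebra p)) = Ideal.span {L'₂} := by
  obtain ⟨v, hv⟩ := h₁.exists_units_smul_eq hp2 h₂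
  have hX : (PowerSeries.X : IwasawaAlgebra p) ≠ 0 := PowerSeries.X_ne_zero
  have h : L'₂ = (v : ℤ_[p]) • L'₁ := by
    apply mul_left_cancel₀ hX
    rw [← hL₂, hv, hL₁, Algebra.smul_def, Algebra.smul_def, mul_left_comm]
  rw [h, Algebra.smul_def]
  exact (Ideal.span_singleton_mul_left_unit ((v.map (algebraMap ℤ_[p] (IwasawaAlgebra p) :
    ℤ_[p] →* IwasawaAlgebra p)).isUnit) L'₁).symm

/-- **The constant term `L_p⁺(E, η, 0)` is determined up to a unit** (it is the (3.6) quantity for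
Kobayashi's function; choice-free up to `ℤ_pˣ`, so in particular `L(0) = 0` is choice-free).
[cite: Kobayashi2003, (3.6) (p. 7)] -/
theorem IsQuadraticBranchPlusLFunction.constantCoeff_eq_zero_iff (hp2 : p ≠ 2) {ϖ : ℚ}
    {L₁ L₂ : IwasawaAlgebra p} (h₁ : IsQuadraticBranchPlusLFunction f p ϖ L₁)
    (h₂ : IsQuadraticBranchPlusLFunction f p ϖ L₂) :
    PowerSeries.constantCoeff L₁ = 0 ↔ PowerSeries.constantCoeff L₂ = 0 := by
  obtain ⟨v, hv⟩ := h₁.exists_units_smul_eq hp2 h₂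
  rw [hv, ← PowerSeries.coeff_zero_eq_constantCoeff_apply, ← PowerSeries.coeff_zero_eq_constantCoeff_apply,
    PowerSeries.coeff_smul, smul_eq_mul, Units.mul_right_eq_zero]

/-- **The leading coefficient `coeff₁ L_p⁻(E, η, X)` is determined up to a unit**, so
`coeff₁ L₁ = 0 ↔ coeff₁ L₂ = 0` (the 'order of vanishing exactly one on the odd branch' reading is
choice-free). [cite: Kobayashi2003, (3.5), (3.7) (p. 7)] -/
theorem IsQuadraticBranchMinusLFunction.coeff_one_eq_zero_iff (hp2 : p ≠ 2) {ϖ : ℚ}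
    {L₁ L₂ : IwasawaAlgebra p} (h₁ : IsQuadraticBranchMinusLFunction f p ϖ L₁)
    (h₂ : IsQuadraticBranchMinusLFunction f p ϖ L₂) :
    PowerSeries.coeff 1 L₁ = 0 ↔ PowerSeries.coeff 1 L₂ = 0 := by
  obtain ⟨v, hv⟩ := h₁.exists_units_smul_eq hp2 h₂
  rw [hv, PowerSeries.coeff_smul, smul_eq_mul, Units.mul_right_eq_zero]

end Unique

/-! ## §3 (appended, proofs only) Non-vacuity of the odd reading: `X ∣ L_p⁻(E, η, X)` ((3.7)) -/

section DivX

variable {N : ℕ} {f : CuspForm (Gamma0 N) 2}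

/-- **(3.7): `X` divides Kobayashi's `L_p⁻(E, η, X)`** — in the tree the predicate
`IsQuadraticBranchMinusLFunction f p ϖ L` CARRIES the clause `L(0) = 0` ([Kob03] (3.7)
«`L_p⁻(E, η, 0) = 0`», p. 7), so every solution is divisible by `X` in `Λ = ℤ_p⟦X⟧`. Consequence for
the readings quantified «`∀ L'`, `Lm = X·L' → …`» (the odd main conjecture at `η ≠ 1`,
«`Char X⁻(E/K_∞)^η = ((1/X)L⁻_p(E, η, X))`», §4 p. 8; the (S−) clause of
`BurungaleTian2026.thm26_etaKatoSequences_charIdeal_upToP_of_cm`; §5 of that file): they are NEVER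
vacuous — an `L'` always exists (referee GLANCE R-BT26-η G39, NIT-1, answered).
[cite: Kobayashi2003, Thm. 3.2 and (3.7) (p. 7), §4 (p. 8)] -/
theorem IsQuadraticBranchMinusLFunction.X_dvd {ϖ : ℚ} {L : IwasawaAlgebra p}
    (h : IsQuadraticBranchMinusLFunction f p ϖ L) : (PowerSeries.X : IwasawaAlgebra p) ∣ L :=
  PowerSeries.X_dvd_iff.mpr h.1

/-- **… so `L = X·L'` for some `L' ∈ Λ`** (the `L'` of the odd readings).
[cite: Kobayashi2003, (3.7) (p. 7), §4 (p. 8)] -/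
theorem IsQuadraticBranchMinusLFunction.exists_eq_X_mul {ϖ : ℚ} {L : IwasawaAlgebra p}
    (h : IsQuadraticBranchMinusLFunction f p ϖ L) :
    ∃ L' : IwasawaAlgebra p, L = PowerSeries.X * L' :=
  h.X_dvd

end DivX

end Literature.NumberTheory.EllipticCurves.Kobayashi2003

end
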